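import Summits.BirchSwinnertonDyer.Rank1Residual.X5.TwoAdicTargetsAlpha
import Summits.BirchSwinnertonDyer.Rank1Residual.X5.TwoAdicImageCriteria
import HarnessLib

/-!
# Route ByReductionTypeAtTwo, crux `OrdKatoHalfAtTwoIso` (stmt-BirchSwinnertonDyer-19573), stub
# `stub_surj`: the DISPLAYED binder «Kato's integral divisibility at a good ordinary `2` for
# 2-adically surjective curves» (reserve wall W_K2 + the cell's MEMO-6) and its doors

Seat `bsd-2adic-ord` GEN 8 (HOME `run/shared/lean/pub/bsd-2adic/`, MEMO-5 / MEMO-5-ADDENDUM-1 /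
MEMO-6; planner word INBOX 2026-08-26T18:47:34Z (3): «the hV4 binder door as a Theorems helper …
displayed by name in any class file that wants it — a door, not a certificate replacement»).
Theses-free module (pattern of `ByReductionTypeAtTwoMultUpperHalfKatoIntDefs.lean`): ONE `@[conjecture]`
constant + PROVED bookkeeping; nothing asserted.

* `KatoIntAtGoodOrdSurjectiveTwo` — **[crux, MEMO/RESERVE] Kato's divisibility at a good ordinary `2`,
  2-power part included, BSD-period normalisation**: for every globally minimal elliptic `W/ℚ` with
  good ordinary reduction at `2` and `ρ_{W,2^∞}(G_ℚ) = GL₂(ℤ₂)`, the typed item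
  `X5.O1.MainConjectureLowerDivisibilityAtTwoOrd W` (`char_Λ X(E/ℚ_∞) ∋ g`, `ι g = ϖ·L₂(f,α)`,
  `ϖ·Ω_W = Ω⁺_f`). For `Δ_W < 0` this is Theorem B of the prior programme's reserve wall W_K2
  (`run/shared/lean/archive/2001/summits/bsd-w-kato-divisibility-at-2/free/w2/paper/paper.tex` v1e,
  review UPHELD 2026-08-07; Rubin's `Λ`-adic Euler-system theorem II.3.8(ii) over `ℚ_∞` + Kato
  12.6 gcd + four facts at `2`), re-derived independently in the cell's MEMO-5 ([KK4] engine); for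
  `Δ_W > 0` W_K2 gives it up to the archimedean factor `c_∞ = 2` and the cell's MEMO-6 (W_K2♯,
  complex-conjugation invariance of Kato's integral system + half Euler system over the totally real
  Kolyvagin fields; referee verdict PENDING) removes the factor. NOT in print (Kato Thm. 17.4 (3),
  12.4 (3), 12.5 (4), 13.4 (3) all assume `p ≠ 2`). Nothing asserted.
* `mainConjectureLowerDivisibilityAtTwoOrd_of_katoInt` — the binder AT a curve (the `TwoAdicSurjective`
  part of `stub_surj`; the residue of `stub_surj` beyond it is `ρ̄₂ onto ∧ ρ_{2^∞} not onto`).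
* `mainConjectureLowerDivisibilityAtTwoOrd_of_katoInt_of_dokchitser` — the same with the habitat binder
  discharged from Dokchitser–Dokchitser data (PRINT `hDD`, `hlift` + decidable per-curve data).
* `missingUpperBoundAt_two_of_katoInt` — binder + PRINT {Greenberg 4.1@2 (`hEC`), modularity, GZK,
  Kato 17.4 (1) at 2} ⇒ the UPPER half `MissingUpperBoundAt W 2` on a rank-`0` curve
  (through `O1.missingUpperBoundAt_two_of_mainConjectureLowerDivisibilityAtTwoOrd_of_kato`).
* `bsdp_two_of_katoInt_of_missingLowerBoundAt` — + a certified LOWER half (`MissingLowerBoundAt W 2`,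
  descent certificate) ⇒ `BSDp W 2`. This is the per-class door of MEMO-5 ADDENDUM-1 §D.2: PRINT +
  RESERVE/MEMO binder + ONE certificate; no `λ`/`μ` certificate, no tower.

HONEST FRAMING (cell `bsd-2adic`): a memo-grade / reserve-grade binder DISPLAYED by name, not a Literature
fact and not a kernel theorem; per the cell's bar rows through this door are NO-OFFER until the binder
is print or kernel. PARTITION: X5@2 good-ord (B1·O1; 611 classes; habitat of the binder = the 436
E[2]-irreducible 2-adically-surjective classes) × p = 2 — types-the-object-of; closes none; nothing booked.
-/

set_option autoImplicit false
set_option linter.dupNamespace false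

noncomputable section

open scoped Classical MatrixGroups ModularForm

open CongruenceSubgroup WeierstrassCurve Literature.NumberTheory.EllipticCurves
  Literature.NumberTheory.EllipticCurves.ModularForms
  Literature.NumberTheory.EllipticCurves.Rank1Residual
  Literature.NumberTheory.EllipticCurves.Rank1Residual.Typed
  Summit.BirchSwinnertonDyer.Rank1Residual.X5

namespace Summit.BirchSwinnertonDyer.BirchSwinnertonDyer.Theorems.OrdKatoIntAtTwo

/-- [crux, MEMO/RESERVE] **Kato's integral divisibility at a good ordinary `2` for 2-adically surjective
curves, BSD-period normalisation**: for every globally minimal elliptic `W/ℚ`, good ordinary at `2`,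
with `ρ_{W,2^∞}(G_ℚ) = GL₂(ℤ₂)`: `X5.O1.MainConjectureLowerDivisibilityAtTwoOrd W`, i.e. for every
cyclotomic datum, the newform `f` of level `N_W`, every `ϖ` with `ϖ·Ω_W = Ω⁺_f` and every Selmer dual
datum `D`, some `g ∈ char_Λ X` has `ι g = ϖ·L₂(f, α)`. `Δ_W < 0`: reserve wall W_K2 Thm. B (refereed,
UPHELD 2026-08-07) = cell MEMO-5 Thm. B; `Δ_W > 0`: cell MEMO-6 Thm. C (W_K2♯; referee pending).
NOT in print at `p = 2`. Nothing asserted.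
[cite: Kato2004Asterisque, Thm. 12.4–12.6 (pp. 221–223), Thm. 17.4 (p. 273) and 17.13 (pp. 279–280) (shape; the p = 2 integral clause is NOT in print)]
[cite: Rubin2000, Thm. II.3.8 (shape of the engine)] -/
@[conjecture] def KatoIntAtGoodOrdSurjectiveTwo : Prop :=
  ∀ (W : WeierstrassCurve ℚ) [W.IsElliptic] [W.IsGloballyMinimal],
    GoodOrd W 2 → O1.TwoAdicSurjective W → O1.MainConjectureLowerDivisibilityAtTwoOrd W

/-- `KatoIntAtGoodOrdSurjectiveTwo` unfolds to its displayed body. [folklore] -/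
theorem katoIntAtGoodOrdSurjectiveTwo_iff : KatoIntAtGoodOrdSurjectiveTwo ↔
    ∀ (W : WeierstrassCurve ℚ) [W.IsElliptic] [W.IsGloballyMinimal],
      GoodOrd W 2 → O1.TwoAdicSurjective W → O1.MainConjectureLowerDivisibilityAtTwoOrd W :=
  Iff.rfl

variable (W : WeierstrassCurve ℚ) [W.IsElliptic] [W.IsGloballyMinimal]

/-- **The binder AT a curve** — the `TwoAdicSurjective` part of the registered stub `stub_surj` of
crux `OrdKatoHalfAtTwoIso` (whose hypothesis is only `ρ̄₂` onto; the residue `ρ̄₂ onto ∧ ρ_{2^∞} not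
onto` — `√Δ ∈ ℚ(μ_{2^∞})` or `j = −4t³(t+8)` by Dokchitser–Dokchitser — is NOT covered by the binder).
[folklore] -/
theorem mainConjectureLowerDivisibilityAtTwoOrd_of_katoInt (h : KatoIntAtGoodOrdSurjectiveTwo)
    (hgo : GoodOrd W 2) (him : O1.TwoAdicSurjective W) :
    O1.MainConjectureLowerDivisibilityAtTwoOrd W :=
  h W hgo him

omit [W.IsGloballyMinimal] in
/-- **The habitat binder from decidable data**: no rational point of order `2`,
`Δ, −Δ, 2Δ, −2Δ ∉ ℚ^{×2}`, `j ≠ −4t³(t+8)` ⟹ `TwoAdicSurjective W`, modulo the two PRINT facts of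
`X5/TwoAdicImageCriteria.lean` (Dokchitser–Dokchitser 2012 + the mod-`8` lift). Re-export for class files.
[cite: DokchitserDokchitserMathZ2012, Theorem (p. 961)] [cite: RouseZureickbrown2015, §3 Lemma and §1] -/
theorem twoAdicSurjective_of_dokchitser_data
    (hDD : DokchitserDokchitser2012_surjective_mod_two_four_eight)
    (hlift : hasSurjectiveModNGaloisRep_two_pow_of_eight)
    (h2 : ∀ P : W.toAffine.Point, 2 • P = 0 → P = 0) (hΔ : ¬ IsSquare W.Δ)
    (hΔ₁ : ¬ IsSquare (-W.Δ)) (hΔ₂ : ¬ IsSquare (2 * W.Δ)) (hΔ₃ : ¬ IsSquare (-2 * W.Δ))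
    (hj : ∀ t : ℚ, W.j ≠ -4 * t ^ 3 * (t + 8)) : O1.TwoAdicSurjective W :=
  O1.twoAdicSurjective_of_dokchitser W hDD hlift h2 hΔ hΔ₁ hΔ₂ hΔ₃ hj

/-- **The binder AT a curve, habitat discharged from Dokchitser–Dokchitser data.** [folklore]
[cite: DokchitserDokchitserMathZ2012, Theorem (p. 961)] -/
theorem mainConjectureLowerDivisibilityAtTwoOrd_of_katoInt_of_dokchitser
    (h : KatoIntAtGoodOrdSurjectiveTwo)
    (hDD : DokchitserDokchitser2012_surjective_mod_two_four_eight)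
    (hlift : hasSurjectiveModNGaloisRep_two_pow_of_eight)
    (hgo : GoodOrd W 2) (h2 : ∀ P : W.toAffine.Point, 2 • P = 0 → P = 0) (hΔ : ¬ IsSquare W.Δ)
    (hΔ₁ : ¬ IsSquare (-W.Δ)) (hΔ₂ : ¬ IsSquare (2 * W.Δ)) (hΔ₃ : ¬ IsSquare (-2 * W.Δ))
    (hj : ∀ t : ℚ, W.j ≠ -4 * t ^ 3 * (t + 8)) :
    O1.MainConjectureLowerDivisibilityAtTwoOrd W :=
  h W hgo (O1.twoAdicSurjective_of_dokchitser W hDD hlift h2 hΔ hΔ₁ hΔ₂ hΔ₃ hj)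

/-- **Binder + PRINT ⇒ the UPPER half on a rank-`0` good-ordinary 2-adically-surjective curve**:
Greenberg Thm. 4.1 at `2` (`hEC`, slot `δ = 0`), modularity (`hmod`), GZK (`hGZK`), Kato Thm. 17.4 (1)
at `2` (`h17`, torsion of `X` only) and the binder give `MissingUpperBoundAt W 2`
(`ord₂ #Ш ≤ ord₂ #Ш_an`) — through the landed G11a′ chain
`O1.missingUpperBoundAt_two_of_mainConjectureLowerDivisibilityAtTwoOrd_of_kato`. [cite: GreenbergLNM1716, Thm. 4.1 (p. 102)]
[cite: Kato2004Asterisque, Thm. 17.4 (1) (p. 273)] [cite: Miller2011LMS, Def. 1.1] -/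
theorem missingUpperBoundAt_two_of_katoInt (h : KatoIntAtGoodOrdSurjectiveTwo)
    (hEC : O1.TwoAdicEulerCharRankZero W 0) (hmod : nonempty_modularParametrizationData)
    (hGZK : rank_eq_analyticRank_of_analyticRank_le_one)
    (h17 : ∀ [NeZero (W.conductorNorm ℤ)] (f : CuspForm (Gamma0 (W.conductorNorm ℤ)) 2),
      kato_divisibility_allPrimes W 2 (f := f))
    (hr : W.analyticRank = 0) (hgo : GoodOrd W 2) (him : O1.TwoAdicSurjective W) :
    MissingUpperBoundAt W 2 :=
  O1.missingUpperBoundAt_two_of_mainConjectureLowerDivisibilityAtTwoOrd_of_kato W hEC hmod hGZK h17 hr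
    hgo (h W hgo him)

/-- **The per-class door of MEMO-5 ADDENDUM-1 §D.2**: binder + PRINT {`hEC`, `hmod`, `hGZK`, `h17`} +
ONE descent certificate (`hlow : MissingLowerBoundAt W 2`, i.e. `ord₂ #Ш_an ≤ ord₂ #Ш`) ⇒ `BSD(E,2)`
on a rank-`0` good-ordinary curve with `ρ_{E,2^∞}` onto — no `λ`/`μ` certificate, no tower, no
Greenberg Prop-5.14 point. [cite: Miller2011LMS, Def. 1.1 and §1] [cite: GreenbergLNM1716, Thm. 4.1 (p. 102)] -/
theorem bsdp_two_of_katoInt_of_missingLowerBoundAt (h : KatoIntAtGoodOrdSurjectiveTwo)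
    (hEC : O1.TwoAdicEulerCharRankZero W 0) (hmod : nonempty_modularParametrizationData)
    (hGZK : rank_eq_analyticRank_of_analyticRank_le_one)
    (h17 : ∀ [NeZero (W.conductorNorm ℤ)] (f : CuspForm (Gamma0 (W.conductorNorm ℤ)) 2),
      kato_divisibility_allPrimes W 2 (f := f))
    (hr : W.analyticRank = 0) (hgo : GoodOrd W 2) (him : O1.TwoAdicSurjective W)
    (hlow : MissingLowerBoundAt W 2) : BSDp W 2 :=
  bsdp_of_missingPPartAt W 2 hGZK (by rw [hr]; exact zero_le_one)
    (missingPPartAt_of_lower_of_upper W 2 hlow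
      (missingUpperBoundAt_two_of_katoInt W h hEC hmod hGZK h17 hr hgo him))

/-- **The same door with the habitat discharged from Dokchitser–Dokchitser data** (all displayed
inputs = PRINT facts by name + the binder + decidable per-curve data + one descent certificate).
[cite: DokchitserDokchitserMathZ2012, Theorem (p. 961)] [cite: Miller2011LMS, Def. 1.1 and §1] -/
theorem bsdp_two_of_katoInt_of_dokchitser_of_missingLowerBoundAt (h : KatoIntAtGoodOrdSurjectiveTwo)
    (hDD : DokchitserDokchitser2012_surjective_mod_two_four_eight)
    (hlift : hasSurjectiveModNGaloisRep_two_pow_of_eight)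
    (hEC : O1.TwoAdicEulerCharRankZero W 0) (hmod : nonempty_modularParametrizationData)
    (hGZK : rank_eq_analyticRank_of_analyticRank_le_one)
    (h17 : ∀ [NeZero (W.conductorNorm ℤ)] (f : CuspForm (Gamma0 (W.conductorNorm ℤ)) 2),
      kato_divisibility_allPrimes W 2 (f := f))
    (hr : W.analyticRank = 0) (hgo : GoodOrd W 2)
    (h2 : ∀ P : W.toAffine.Point, 2 • P = 0 → P = 0) (hΔ : ¬ IsSquare W.Δ)
    (hΔ₁ : ¬ IsSquare (-W.Δ)) (hΔ₂ : ¬ IsSquare (2 * W.Δ)) (hΔ₃ : ¬ IsSquare (-2 * W.Δ))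
    (hj : ∀ t : ℚ, W.j ≠ -4 * t ^ 3 * (t + 8)) (hlow : MissingLowerBoundAt W 2) : BSDp W 2 :=
  bsdp_two_of_katoInt_of_missingLowerBoundAt W h hEC hmod hGZK h17 hr hgo
    (O1.twoAdicSurjective_of_dokchitser W hDD hlift h2 hΔ hΔ₁ hΔ₂ hΔ₃ hj) hlow

end Summit.BirchSwinnertonDyer.BirchSwinnertonDyer.Theorems.OrdKatoIntAtTwo

end
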